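/-
Copyright (c) 2026 the pub-hodgecm-mathlib formalisation cell (harness21).  Prover seat hodgecm-mathlib-LH4-p16 (g2), req620 Track A «(D-RAM) FOUR-FRAME» squad
(STAGE-1b, row (2) of the piece `f_{T₊}`, the (β₂) road (R-36); β₂ sub-dealer LH4-p04 (g9), lane-C hinge LH7-p10 (g2); MECH-K2 v1 §2 «the two literals see the two
`M∕K`-norm halves»: K5-C, second file), 2026-09-04.
-/
import Summits.HodgeConjecture.HodgeConjecture.Theorems.F0P3cDyRamToricCensusDefs    -- ★ DEFS (LH4): brings the valued-field preamble; no definition of it is used here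
import HarnessLib

/-!
# Crux `H413`, line LH4 «(D-RAM) FOUR-FRAME» — STAGE-1b, row (2), the (β₂) road (R-36), lane C, (ROW-INT)_C, K5-C (2): «THE `Θ`-NORM CLASS OF A `Θ`-FIXED UNIT IS READ BY
# ITS `ρ`-NORM» — from the frame letters `_c13` (dichotomy with `c₀`) and `_c20` (a witness) alone

Cell `hodgecm-mathlib` (D-0151), FLOOR 0, crux item H413 = `stmt-HodgeConjecture-24833`, route of record `HCCMUnconditional`; squad F0∕P3c∕LH4; lane
`--supports stmt-HodgeConjecture-24833 --as helper` (count-neutral; pays NO tier-0 row).  THEOREMS ONLY (no `def`, no instance, no notation, no `sorry`, default heartbeats);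
★-only imports; states NO law; (β₂) stays a HYPOTHESIS.  DATUM-FREE one-field letters: `M` with two commuting ring endomorphisms `ρ`, `Θ` (`ρ² = 1`), a `Θ`-fixed `c₀`, and the
two frame letters of tier-0's lane-C block VERBATIM in shape: `_c13 : ∀ x, Θ x = x → |x| = 1 → (∃ z, zΘz = x) ∨ ∃ z, zΘz = c₀·x` and `_c20 : ∃ a, Θ a = a ∧ |a| = 1 ∧ ¬ ∃ e, ρ e = e ∧ eΘe = a·ρa`.
WHY (MECH-K2 v1 `F0/P3c/LH4/LH4-p16/g2/MECH-K2.v1.LH4p16g2.md` §2, §4(b); K5-C (1) ★-cand `…RowVertexCoordinateChange` §4).  In lane C (`M∕K` RAMIFIED, `K = Fix Θ`) a row cell's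
scalars `D₀ = h·N_Θ(x₀)·N_Θ(cc(α − ρα))` lie in ONE class of `K^× ∕ F^×·N_Θ(M^×)` (index two); the two literals' `h` differ by the non-norm class, so a tower is populated on ONE literal
(F0P3-p01's PURE-CELL-LEDGER v2: lit1 = {D, K₀, T₂, T₃, …}, lit2 = {D, K₀, T₁}) and the transport multiplier of K5-C (1) §4 is realisable by a generator `e·x₀` iff it is a `Θ`-norm.
To DECIDE the class inside tier-0's letters one needs a test; THIS FILE derives the classical one — **a `Θ`-fixed unit `x` is a `Θ`-norm iff its `ρ`-norm `x·ρx` is the `Θ`-norm of a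
`ρ`-FIXED element** (local class field theory for the biquadratic `M ⊃ K, jE(E), K′ ⊃ jE(F)`: `χ_{M∕K} = χ_{E∕F} ∘ N_{K∕F}`; the right side is the `E∕F`-norm class `ω(N_{K∕F} x)`, i.e. the
SAME character `ω = normSign` that reads the labels, ★ p862927) — from `_c13` + `_c20` + `Θρ = ρΘ` only:
* §1 `normTheta_mul_map_normTheta` (`N_Θz·ρ(N_Θz) = N_Θ(z·ρz)`), `exists_fixed_normTheta_of_normTheta` (⟹);
* §2 `not_exists_fixed_normTheta_c0` (`c₀·ρc₀` is NOT the `Θ`-norm of a `ρ`-fixed element — the witness of `_c20` is in `c₀`'s class), `c0_not_normTheta`;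
* §3 `exists_normTheta_of_fixed_normTheta` (⟸), HEAD `exists_normTheta_iff_exists_fixed_normTheta` (⟺), and the coset reading `exists_normTheta_mul_c0_iff` (`c₀·x` is a norm iff `x` is not).
WHAT IS NOT CLAIMED: the `E`-side dictionary `(∃ e ρ-fixed, eΘe = jE f) ↔ f ∈ N(E^×)` (★ p861454 ∕ ★ p862927 currency — one `hjfix` step, left to the consumer), any count.
HONEST LABEL.  Count-neutral algebra; nothing printed is asserted; no census law is stated; `HC_CM` is proved only modulo the 7 printed citations (2 remaining named inputs: hLiu418 =
`stmt-HodgeConjecture-24832`, h413 = `stmt-HodgeConjecture-24833`) until rung 0 closes.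
## References
* [Serre1979] J.-P. Serre, *Local Fields*, GTM 67 (1979): Ch. V §3 Cor. 3, Ch. XIV §6 (norm groups of a biquadratic extension; functoriality of the norm residue symbol under `N_{K∕F}`).
* [Rogawski1990] J. D. Rogawski, *Automorphic Representations of Unitary Groups in Three Variables*, Ann. of Math. Stud. 123 (1990): §4.9 p. 55, §12.2 (the quadratic characters at a place).
* [LanglandsShelstad1987] R. P. Langlands, D. Shelstad, *On the definition of transfer factors*, Math. Ann. 278 (1987): §2 (the characters `χ_{E∕F} ∘ N`).
-/

set_option autoImplicit false

noncomputable section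

namespace Summit.HodgeConjecture.HodgeConjecture.Cruxes.H413.F0P3cDyRamThetaNormClassReciprocity

open scoped Valued WithZero

variable {M : Type} [Field M] [Valued M ℤᵐ⁰] {ρ Θ : M →+* M}

/-! ## §1 A `Θ`-norm has a `ρ`-norm that is the `Θ`-norm of a `ρ`-fixed element -/

omit [Valued M ℤᵐ⁰] in
/-- **`(zΘz)·ρ(zΘz) = (zρz)·Θ(zρz)`** (`Θρ = ρΘ`). [cite: Serre1979, Ch. XIV §6] -/
theorem normTheta_mul_map_normTheta (hΘρ : ∀ x, Θ (ρ x) = ρ (Θ x)) (z : M) :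
    z * Θ z * ρ (z * Θ z) = (z * ρ z) * Θ (z * ρ z) := by
  rw [map_mul, map_mul, ← hΘρ]; ring

omit [Valued M ℤᵐ⁰] in
/-- **⟹**: if `x = zΘz` then `x·ρx = eΘe` with `e := z·ρz` `ρ`-FIXED (`ρ² = 1`). [cite: Serre1979, Ch. XIV §6] -/
theorem exists_fixed_normTheta_of_normTheta (hρρ : ∀ x, ρ (ρ x) = x) (hΘρ : ∀ x, Θ (ρ x) = ρ (Θ x)) {x : M} (hx : ∃ z, z * Θ z = x) :
    ∃ e : M, ρ e = e ∧ e * Θ e = x * ρ x := by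
  obtain ⟨z, rfl⟩ := hx
  exact ⟨z * ρ z, by rw [map_mul, hρρ, mul_comm], (normTheta_mul_map_normTheta hΘρ z).symm⟩

/-! ## §2 The non-norm representative `c₀`: its `ρ`-norm is not the `Θ`-norm of a `ρ`-fixed element -/

/-- **`c₀·ρc₀` IS NOT THE `Θ`-NORM OF A `ρ`-FIXED ELEMENT.**  From the dichotomy `_c13`, `|c₀| = 1` (`_c12`) and the witness `_c20`: the witness `a` is not a `Θ`-norm (§1), so
`c₀·a = zΘz`; if `c₀ρc₀ = eΘe` with `ρe = e` then `aρa = N_Θ(zρz ∕ e)` with `zρz∕e` `ρ`-fixed — contradicting `_c20`. [cite: Serre1979, Ch. XIV §6] [cite: LanglandsShelstad1987, §2] -/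
theorem not_exists_fixed_normTheta_c0 (hρρ : ∀ x, ρ (ρ x) = x) (hΘρ : ∀ x, Θ (ρ x) = ρ (Θ x)) {c₀ : M} (hc₀1 : Valued.v c₀ = 1)
    (hdich : ∀ x : M, Θ x = x → Valued.v x = 1 → (∃ z : M, z * Θ z = x) ∨ ∃ z : M, z * Θ z = c₀ * x)
    (hwit : ∃ a : M, Θ a = a ∧ Valued.v a = 1 ∧ ¬ ∃ e : M, ρ e = e ∧ e * Θ e = a * ρ a) :
    ¬ ∃ e : M, ρ e = e ∧ e * Θ e = c₀ * ρ c₀ := by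
  obtain ⟨a, hΘa, ha1, hnot⟩ := hwit
  have hc0 : c₀ ≠ 0 := fun h0 => by rw [h0, map_zero] at hc₀1; exact zero_ne_one hc₀1
  have hρc0 : ρ c₀ ≠ 0 := (map_ne_zero ρ).2 hc0
  rintro ⟨e, hρe, hee⟩
  rcases hdich a hΘa ha1 with hz | ⟨z, hz⟩
  · exact hnot (exists_fixed_normTheta_of_normTheta hρρ hΘρ hz)
  · have he0 : e ≠ 0 := fun h0 => by rw [h0, zero_mul] at hee; exact mul_ne_zero hc0 hρc0 hee.symm
    refine hnot ⟨z * ρ z / e, by rw [map_div₀, map_mul, hρρ, hρe, mul_comm], ?_⟩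
    have key : (z * ρ z) * Θ (z * ρ z) = (c₀ * a) * ρ (c₀ * a) := by rw [← normTheta_mul_map_normTheta hΘρ z, hz]
    rw [map_div₀, div_mul_div_comm, key, hee, map_mul]
    field_simp

/-- Hence **`c₀` IS NOT A `Θ`-NORM**. [cite: Serre1979, Ch. XIV §6] -/
theorem c0_not_normTheta (hρρ : ∀ x, ρ (ρ x) = x) (hΘρ : ∀ x, Θ (ρ x) = ρ (Θ x)) {c₀ : M} (hc₀1 : Valued.v c₀ = 1)
    (hdich : ∀ x : M, Θ x = x → Valued.v x = 1 → (∃ z : M, z * Θ z = x) ∨ ∃ z : M, z * Θ z = c₀ * x)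
    (hwit : ∃ a : M, Θ a = a ∧ Valued.v a = 1 ∧ ¬ ∃ e : M, ρ e = e ∧ e * Θ e = a * ρ a) :
    ¬ ∃ z : M, z * Θ z = c₀ := fun h =>
  not_exists_fixed_normTheta_c0 hρρ hΘρ hc₀1 hdich hwit (exists_fixed_normTheta_of_normTheta hρρ hΘρ h)

/-! ## §3 ⟸ and the HEAD equivalence; the coset reading -/

/-- **⟸**: a `Θ`-fixed unit `x` whose `ρ`-norm is the `Θ`-norm of a `ρ`-fixed element IS a `Θ`-norm (else `c₀x = zΘz` and `c₀ρc₀ = N_Θ(zρz∕e)`, §2). [cite: Serre1979, Ch. XIV §6] -/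
theorem exists_normTheta_of_fixed_normTheta (hρρ : ∀ x, ρ (ρ x) = x) (hΘρ : ∀ x, Θ (ρ x) = ρ (Θ x)) {c₀ : M} (hc₀1 : Valued.v c₀ = 1)
    (hdich : ∀ x : M, Θ x = x → Valued.v x = 1 → (∃ z : M, z * Θ z = x) ∨ ∃ z : M, z * Θ z = c₀ * x)
    (hwit : ∃ a : M, Θ a = a ∧ Valued.v a = 1 ∧ ¬ ∃ e : M, ρ e = e ∧ e * Θ e = a * ρ a)
    {x : M} (hΘx : Θ x = x) (hx1 : Valued.v x = 1) (hfix : ∃ e : M, ρ e = e ∧ e * Θ e = x * ρ x) :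
    ∃ z : M, z * Θ z = x := by
  rcases hdich x hΘx hx1 with h | ⟨z, hz⟩
  · exact h
  · exfalso
    obtain ⟨e, hρe, hee⟩ := hfix
    have hx0 : x ≠ 0 := fun h0 => by rw [h0, map_zero] at hx1; exact zero_ne_one hx1
    have hρx0 : ρ x ≠ 0 := (map_ne_zero ρ).2 hx0
    have he0 : e ≠ 0 := fun h0 => by rw [h0, zero_mul] at hee; exact mul_ne_zero hx0 hρx0 hee.symm
    refine not_exists_fixed_normTheta_c0 hρρ hΘρ hc₀1 hdich hwit ⟨z * ρ z / e, by rw [map_div₀, map_mul, hρρ, hρe, mul_comm], ?_⟩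
    have key : (z * ρ z) * Θ (z * ρ z) = (c₀ * x) * ρ (c₀ * x) := by rw [← normTheta_mul_map_normTheta hΘρ z, hz]
    rw [map_div₀, div_mul_div_comm, key, hee, map_mul]
    field_simp

/-- **HEAD — «THE `Θ`-NORM CLASS OF A `Θ`-FIXED UNIT IS READ BY ITS `ρ`-NORM».**  Under `ρ² = 1`, `Θρ = ρΘ`, `|c₀| = 1`, the dichotomy `_c13` and the witness `_c20`: a `Θ`-fixed
unit `x` is a `Θ`-norm `zΘz` iff `x·ρx = eΘe` for some `ρ`-FIXED `e` (the `E∕F`-norm class of `N_{K∕F} x` — `χ_{M∕K} = χ_{E∕F} ∘ N_{K∕F}`). [cite: Serre1979, Ch. XIV §6]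
[cite: LanglandsShelstad1987, §2] [cite: Rogawski1990, §12.2] -/
theorem exists_normTheta_iff_exists_fixed_normTheta (hρρ : ∀ x, ρ (ρ x) = x) (hΘρ : ∀ x, Θ (ρ x) = ρ (Θ x)) {c₀ : M} (hc₀1 : Valued.v c₀ = 1)
    (hdich : ∀ x : M, Θ x = x → Valued.v x = 1 → (∃ z : M, z * Θ z = x) ∨ ∃ z : M, z * Θ z = c₀ * x)
    (hwit : ∃ a : M, Θ a = a ∧ Valued.v a = 1 ∧ ¬ ∃ e : M, ρ e = e ∧ e * Θ e = a * ρ a)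
    {x : M} (hΘx : Θ x = x) (hx1 : Valued.v x = 1) :
    (∃ z : M, z * Θ z = x) ↔ ∃ e : M, ρ e = e ∧ e * Θ e = x * ρ x :=
  ⟨exists_fixed_normTheta_of_normTheta hρρ hΘρ, exists_normTheta_of_fixed_normTheta hρρ hΘρ hc₀1 hdich hwit hΘx hx1⟩

/-- **THE COSET READING**: for a `Θ`-fixed unit `x`, `c₀·x` is a `Θ`-norm iff `x` is NOT (the two classes; `c₀` is not a norm, §2). [cite: Serre1979, Ch. XIV §6] -/
theorem exists_normTheta_mul_c0_iff (hρρ : ∀ x, ρ (ρ x) = x) (hΘρ : ∀ x, Θ (ρ x) = ρ (Θ x)) {c₀ : M} (hc₀1 : Valued.v c₀ = 1)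
    (hdich : ∀ x : M, Θ x = x → Valued.v x = 1 → (∃ z : M, z * Θ z = x) ∨ ∃ z : M, z * Θ z = c₀ * x)
    (hwit : ∃ a : M, Θ a = a ∧ Valued.v a = 1 ∧ ¬ ∃ e : M, ρ e = e ∧ e * Θ e = a * ρ a)
    {x : M} (hΘx : Θ x = x) (hx1 : Valued.v x = 1) :
    (∃ z : M, z * Θ z = c₀ * x) ↔ ¬ ∃ z : M, z * Θ z = x := by
  refine ⟨fun ⟨z₁, hz₁⟩ ⟨z₂, hz₂⟩ => ?_, fun h => (hdich x hΘx hx1).resolve_left h⟩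
  have hx0 : x ≠ 0 := fun h0 => by rw [h0, map_zero] at hx1; exact zero_ne_one hx1
  have hz₂0 : z₂ ≠ 0 := fun h0 => by rw [h0, zero_mul] at hz₂; exact hx0 hz₂.symm
  have hΘz₂0 : Θ z₂ ≠ 0 := (map_ne_zero Θ).2 hz₂0
  refine c0_not_normTheta hρρ hΘρ hc₀1 hdich hwit ⟨z₁ / z₂, ?_⟩
  rw [map_div₀, div_mul_div_comm, hz₁, hz₂, mul_div_cancel_right₀ _ hx0]

end Summit.HodgeConjecture.HodgeConjecture.Cruxes.H413.F0P3cDyRamThetaNormClassReciprocity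

end
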